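import Summits.BirchSwinnertonDyer.BirchSwinnertonDyer.Theorems.EdixhovenFibreFiveSevenStarredOptimalManinUnitFiveSevenOfHasDualExp
import Literature.NumberTheory.PAdicHodge.TateH1BdRFil
import HarnessLib

/-!
# Route `EdixhovenFibreFiveSeven`, crux K★ `StarredOptimalManinUnitFiveSeven` (stmt-BirchSwinnertonDyer-22226): the conditional
# closer RE-KEYED on `H¹(Γ_F, B^m_dR)` (Kato II §1.2.7 for `V = ℚ_p`) in place of Kato II Prop. 1.2.3

Cell `pub/bsd-wall`, seat `bsd-line-edix-p4` g5 (line `kato-lever`, hP′ programme). The K★ closer of seat edix-p2 g8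
(`starredOptimalManinUnitFiveSeven_of_sl2NeronValues_of_hasDualExp`, file `…OfHasDualExp`) displays the cite-only fact
hP′ `hasDualExp_of_isDeRham` (Kato LNM 1553 II Prop. 1.2.3, surjectivity half, for every de Rham `V`). The Literature files
landed by this seat PROVE the filtered comparison for de Rham `V` (`DeRhamFilteredComparison`, Wach 1996 §B.2.3 / Kato II
§1.2.6) and REDUCE hP′ to the `V`-free named fact `kato1993_H1_bdRFil` — Kato II §1.2.7 for `V = ℚ_p`:
`H¹(K, B^m_dR) = K · log χ_cyclo` (`m ≤ 0`), `= 0` (`m ≥ 1`), on cocycles of finite type — by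
`hasDualExp_of_isDeRham_of_kato1993_H1_bdRFil` (file `TateH1BdRFil`). Hence both F″ and K★ are re-keyed on the STRICTLY
MORE PRIMITIVE binder `hH1 : kato1993_H1_bdRFil`:

* `KatoAssemblySocket.kato_neron_five_le_of_sl2NeronValues_of_kato1993_H1_bdRFil (hT₂) (hH1) (hDR) (hP1) : F″`;
* `starredOptimalManinUnitFiveSeven_of_sl2NeronValues_of_kato1993_H1_bdRFil (hT₂) (hH1) (hDR) (hP1) : K★` (conditional
  closer of stmt-BirchSwinnertonDyer-22226; cite cone {P1, (S5b-tower), Kato II §1.2.7 for `V = ℚ_p`, de Rham of `V_pE`}).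

What separates `hH1` from a theorem (tree files `TateGradedDevissage`, `BdRDevissageInputs`): the named fact (TS1)
`tate1967_TS1_completedAlgClosure` and the continuity of the `Γ_F`-action on `B_dR⁺/Fil^n` (the hypothesis `hstep` of the
abstract dévissage); the graded inputs and the completeness are landed.
CONDITIONAL RESULT (gate audit `proof.conditional`): nothing cite-only is discharged here; the item stays OPEN; BSD is not
proved by any of this.
-/

set_option autoImplicit false
-- the Theorems namespace of a single-conjunct summit repeats the summit name by design (D-0017)
set_option linter.dupNamespace false

noncomputable section

namespace Summit.BirchSwinnertonDyer.BirchSwinnertonDyer.Theorems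

/-- **F″ ⟸ P1 + (S5b-tower) + Kato II §1.2.7 (`V = ℚ_p`) + de Rham**: Kato's Néron integrality of twisted symbol sums at
additive `p ≥ 5` (`kato_neron_isIntegral_twistedSymbolSum_of_additive_five_le`), through
`kato_neron_five_le_of_sl2NeronValues_of_hasDualExp` with its hP′ binder fed by
`hasDualExp_of_isDeRham_of_kato1993_H1_bdRFil` (Kato II Prop. 1.2.3 for every de Rham `V` from the filtered comparison).
[cite: Kato2004Asterisque, (8.1.3) (p. 180), Thm. 9.7 (p. 189), Thm. 6.6 (1) (p. 163), Thm. 13.6 (p. 227)]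
[cite: Kato1993LNM1553, Ch. II Prop. 1.2.3, §1.2.6–1.2.7 and Thm. 1.4.1 (3)-(4)] [cite: BlochKato1990, Prop. 3.8 and Example 3.11] -/
theorem KatoAssemblySocket.kato_neron_five_le_of_sl2NeronValues_of_kato1993_H1_bdRFil
    (hT₂ : Literature.NumberTheory.PAdicHodge.exists_smul_range_expStarCoord_tower_iff_trace_log)
    (hH1 : Literature.NumberTheory.PAdicHodge.kato1993_H1_bdRFil)
    (hDR : Literature.NumberTheory.PAdicHodge.isDeRham_restrictedRationalTateRep)
    (hP1 : Literature.NumberTheory.EllipticCurves.Kato2004.exists_member_sl2ZetaElement_neron_values) :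
    Literature.NumberTheory.EllipticCurves.kato_neron_isIntegral_twistedSymbolSum_of_additive_five_le :=
  KatoAssemblySocket.kato_neron_five_le_of_sl2NeronValues_of_hasDualExp hT₂
    (Literature.NumberTheory.PAdicHodge.hasDualExp_of_isDeRham_of_kato1993_H1_bdRFil hH1) hDR hP1

/-- **K★ ⟸ P1 + (S5b-tower) + Kato II §1.2.7 (`V = ℚ_p`) + de Rham** (conditional closer of stmt-BirchSwinnertonDyer-22226,
re-keyed on `kato1993_H1_bdRFil`): Manin's `p`-part at the lattice-optimal datum of an `X₀(N)`-optimal curve of starred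
additive type at `p ∈ {5, 7}` with `E[p]` irreducible — `starredOptimalManinUnitFiveSeven_of_sl2NeronValues_of_hasDualExp` ∘
`hasDualExp_of_isDeRham_of_kato1993_H1_bdRFil`. Kato II Prop. 1.2.3 is no longer assumed: only its `V = ℚ_p`,
`B^m_dR`-level input (§1.2.7) is. [cite: Kato2004Asterisque, (8.1.3) (p. 180), Thm. 9.7 (p. 189), Thm. 6.6 (1) (p. 163), Thm. 13.6 (p. 227)]
[cite: Kato1993LNM1553, Ch. II §1.2.7 and Thm. 1.4.1 (3)-(4)] [cite: EdixhovenManin1991, Thm. 3 and §4] -/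
theorem starredOptimalManinUnitFiveSeven_of_sl2NeronValues_of_kato1993_H1_bdRFil
    (hT₂ : Literature.NumberTheory.PAdicHodge.exists_smul_range_expStarCoord_tower_iff_trace_log)
    (hH1 : Literature.NumberTheory.PAdicHodge.kato1993_H1_bdRFil)
    (hDR : Literature.NumberTheory.PAdicHodge.isDeRham_restrictedRationalTateRep)
    (hP1 : Literature.NumberTheory.EllipticCurves.Kato2004.exists_member_sl2ZetaElement_neron_values) :
    Summit.BirchSwinnertonDyer.BirchSwinnertonDyer.Theses.EdixhovenFibreFiveSeven.StarredOptimalManinUnitFiveSeven :=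
  starredOptimalManinUnitFiveSeven_of_sl2NeronValues_of_hasDualExp hT₂
    (Literature.NumberTheory.PAdicHodge.hasDualExp_of_isDeRham_of_kato1993_H1_bdRFil hH1) hDR hP1

end Summit.BirchSwinnertonDyer.BirchSwinnertonDyer.Theorems

end
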